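import Literature.NumberTheory.GaloisRepresentations.LubinTateColemanCoordCoinvariantTwistTwo
import HarnessLib

/-!
# Base change of the Coleman coordinate module (`q = 2`) along a ring map `κ : S → S'` of `𝒪_F`-algebras: `map κ` intertwines the twists
# `D_v`, `σ_v`, the `Λ`-action `c • r`, and the `ε`-projection `φ_ε` — so the twist scalars `t_v = φ_ε(σ_v 1)` are BASE-CHANGE INVARIANT
# (`t_v` over `𝒪_F⟦X⟧` is the constant `C(t_v)` of `t_v` over `𝒪_F`; every specialisation `X ↦ x` of `φ_ε` is `φ_ε` of the specialisation)

De Shalit, *Iwasawa theory of elliptic curves with complex multiplication* (1987), Ch. I §3.7 ("`i` extended by linearity to the completed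
tensor product `𝒰 ⊗̂ 𝒪`": the Coleman module and its `Λ`-structure are formed over any coefficient ring and are compatible with change of
coefficients), §3.8 (17) (the two-variable algebra `Λ(𝒢; 𝒪) = 𝒪⟦X⟧⟦T⟧` and its specialisations at characters of the unramified direction,
`X ↦ ζ − 1`).  In the tree the coordinate module `ColemanCoordModule hπ hq ι u hu γ = S⟦Y⟧` (`LubinTateColemanCoordModuleTwo`) is built over
an arbitrary base `ι : 𝒪_F → S`; the lane uses `S = 𝒪_E` (one level, `ι = algebraMap`) and `S = 𝒪_F⟦X⟧` (two variables, `ι = intBase`), and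
`twistLinearBase_map` records the compatibility with `map ι` from `𝒪_F⟦Y⟧`.  THIS file proves the compatibility with an ARBITRARY ring map
`κ : S →+* S'` such that `κ ∘ ι = ι'` (everything PROVED, 0 sorry, no definitions, no named facts):

* §1 `map_mem_adicFiltGen_of_comp` (`map κ (I_N^S) ⊆ I_N^{S'}`), ★ `map_twistLinearBase` (`map κ (D_v r) = D_v (map κ r)`), `map_iterate_twistLinearBase`,
  `map_tPartial`, ★★ `map_tAct` (`map κ (c • r) = (map κ c) • (map κ r)`), ★ `map_toPS_unitTwistₗ` (`map κ (σ_v r) = σ_v (map κ r)`).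
* §2 ★★ `repr_coordBasisDelta_map` (the `Λ[Δ]`-coordinates commute with `map κ`), ★★★ **`colemanDeltaCoinvFun_map`** —
  `φ_{map κ ε}(map κ m) = map κ (φ_ε m)`; ★★ **`colemanDeltaCoinvFun_unitTwistₗ_one_map`** — `t_v^{S'} = map κ (t_v^{S})`: the twist scalars are
  base-change invariant.

Use (sequel): with `κ = (X ↦ 0) : 𝒪_F⟦X⟧ → 𝒪_E` the two-variable `φ_ε(Col β)` specialises to the one-level `φ_ε`, whose moments are the Coates–Wiles
values — the route from the (c)-capstone's hypothesis `L_ε ≠ 0` to ONE non-vanishing moment.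

## References
* E. de Shalit, *Iwasawa theory of elliptic curves with complex multiplication* (1987), Ch. I §3.4 Lemma (ii), §3.7, §3.8 (17). [deShalit1987]
* L. C. Washington, *Introduction to Cyclotomic Fields*, 2nd ed. (1997), §13.2. [Washington1997]
-/

noncomputable section

namespace Literature.NumberTheory.GaloisRepresentations

section CoordBaseChangeTwo

open GaloisRepresentations.IsNonarchimedeanLocalField LubinTate ValuativeRel Finset

variable {F : Type} [Field F] [ValuativeRel F] [TopologicalSpace F] [IsNonarchimedeanLocalField F]

attribute [local instance] ltNormUniformSpace ltNormIsUniformAddGroup rk1 nF nE fintypeResidueField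

variable {π : 𝒪[F]} (hπ : (valuation F).IsUniformizer (π : F)) (hq : residueFieldCard F = 2)
variable {S S' : Type*} [CommRing S] [CommRing S'] (ι : LTCoeff F →+* S) (ι' : LTCoeff F →+* S') (κ : S →+* S') (hκ : κ.comp ι = ι')

/-! ### §1. `map κ` intertwines the filtration, the twists and the `Λ`-action -/

omit [TopologicalSpace F] [IsNonarchimedeanLocalField F] in
include hκ in
/-- `κ (ι a) = ι' a`. [cite: deShalit1987, Ch. I §3.7] -/
theorem baseChange_apply (a : LTCoeff F) : κ (ι a) = ι' a := by rw [← hκ, RingHom.comp_apply]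

omit [TopologicalSpace F] [IsNonarchimedeanLocalField F] in
include hκ in
/-- `map κ ∘ map ι = map ι'`. [cite: deShalit1987, Ch. I §3.7] -/
theorem map_map_baseChange (r : PowerSeries (LTCoeff F)) : PowerSeries.map κ (PowerSeries.map ι r) = PowerSeries.map ι' r := by
  rw [← hκ, PowerSeries.map_comp]; rfl

omit [TopologicalSpace F] [IsNonarchimedeanLocalField F] in
include hκ in
/-- **`map κ (I_N^{S}) ⊆ I_N^{S'}`** for the `(ιπ, Y)`- and `(ι'π, Y)`-adic filtrations. [cite: deShalit1987, Ch. I §3.13 Lemma (proof)] -/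
theorem map_mem_adicFiltGen_of_comp {N : ℕ} {V : PowerSeries S} (hV : V ∈ adicFiltGen (ι (LTCoeff.of F π)) N) :
    PowerSeries.map κ V ∈ adicFiltGen (ι' (LTCoeff.of F π)) N := by
  intro k
  rw [PowerSeries.coeff_map]
  obtain ⟨c, hc⟩ := Ideal.mem_span_singleton.mp (hV k)
  refine Ideal.mem_span_singleton.mpr ⟨κ c, ?_⟩
  rw [hc, map_mul, map_pow, baseChange_apply ι ι' κ hκ]

include hκ in
/-- ★ **`map κ (D_v r) = D_v (map κ r)`**: the base-changed twists are compatible with change of base. [cite: deShalit1987, Ch. I §3.4 Lemma (ii), §3.7] -/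
theorem map_twistLinearBase (u : (LTCoeff F)ˣ) (v : 𝒪[F]ˣ) (r : PowerSeries S) :
    PowerSeries.map κ (twistLinearBase hπ hq ι u v r) = twistLinearBase hπ hq ι' u v (PowerSeries.map κ r) := by
  rw [twistLinearBase_apply, twistLinearBase_apply]
  set H := hom (isLTRing_LTCoeff hπ) (isLTSeries_LTCoeff π) (isLTSeries_LTCoeff π) (LTCoeff.of F (v : 𝒪[F])) with hH
  have hs : PowerSeries.HasSubst (PowerSeries.map ι H) := PowerSeries.HasSubst.of_constantCoeff_zero' (by
    rw [← PowerSeries.coeff_zero_eq_constantCoeff, PowerSeries.coeff_map, PowerSeries.coeff_zero_eq_constantCoeff, hH, constantCoeff_hom,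
      map_zero])
  have e : PowerSeries.map κ (PowerSeries.subst (PowerSeries.map ι H) r) =
      PowerSeries.subst (PowerSeries.map ι' H) (PowerSeries.map κ r) := by
    have e1 : PowerSeries.map κ (PowerSeries.subst (PowerSeries.map ι H) r) =
        PowerSeries.subst (PowerSeries.map κ (PowerSeries.map ι H)) (PowerSeries.map κ r) := PowerSeries.map_subst hs r
    rw [map_map_baseChange ι ι' κ hκ] at e1
    exact e1
  rw [map_sub, map_mul, map_mul, PowerSeries.map_C, baseChange_apply ι ι' κ hκ, map_map_baseChange ι ι' κ hκ, e]

include hκ in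
/-- `map κ (D_v^[k] r) = D_v^[k] (map κ r)`. [cite: deShalit1987, Ch. I §3.7] -/
theorem map_iterate_twistLinearBase (u : (LTCoeff F)ˣ) (v : 𝒪[F]ˣ) (k : ℕ) (r : PowerSeries S) :
    PowerSeries.map κ ((⇑(twistLinearBase hπ hq ι u v))^[k] r) = (⇑(twistLinearBase hπ hq ι' u v))^[k] (PowerSeries.map κ r) := by
  induction k generalizing r with
  | zero => rfl
  | succ k ih => rw [Function.iterate_succ_apply, Function.iterate_succ_apply, ← map_twistLinearBase hπ hq ι ι' κ hκ, ih]

include hκ in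
/-- `map κ` on the partial sums `Σ_{k<K} c_k D^k r`. [cite: Washington1997, §13.2] -/
theorem map_tPartial (u : (LTCoeff F)ˣ) (v : 𝒪[F]ˣ) (c r : PowerSeries S) (K : ℕ) :
    PowerSeries.map κ (tPartial (twistLinearBase hπ hq ι u v) c r K) =
      tPartial (twistLinearBase hπ hq ι' u v) (PowerSeries.map κ c) (PowerSeries.map κ r) K := by
  rw [tPartial_def, tPartial_def, map_sum]
  refine sum_congr rfl fun k _ => ?_
  rw [map_mul, PowerSeries.map_C, PowerSeries.coeff_map, map_iterate_twistLinearBase hπ hq ι ι' κ hκ]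

variable [IsAdicComplete (Ideal.span {ι (LTCoeff.of F π)}) S] [IsAdicComplete (Ideal.span {ι' (LTCoeff.of F π)}) S']
variable (u : (LTCoeff F)ˣ) (hu : LTCoeff.of F π = residueFieldCard F * u) (γ : 𝒪[F]ˣ)

include hκ in
/-- ★★ **`map κ (c • r) = (map κ c) • (map κ r)`** for the `Λ`-actions `T ↦ D_γ` over `S` and `S'` (the limit `Σ c_k D^k r` is characterised by
congruences preserved by `map κ`). [cite: deShalit1987, Ch. I §3.7] [cite: Washington1997, §13.2] -/
theorem map_tAct (c r : PowerSeries S) :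
    PowerSeries.map κ (tAct (twistLinearBase hπ hq ι u γ) (twistLinearBase_mem_adicFiltGen_succ hπ hq ι u hu γ) c r) =
      tAct (twistLinearBase hπ hq ι' u γ) (twistLinearBase_mem_adicFiltGen_succ hπ hq ι' u hu γ) (PowerSeries.map κ c) (PowerSeries.map κ r) := by
  refine eq_tAct_of_forall_sub_mem _ fun K => ?_
  rw [← map_tPartial hπ hq ι ι' κ hκ, ← map_sub]
  exact map_mem_adicFiltGen_of_comp ι ι' κ hκ (tAct_sub_tPartial_mem _ c r K)

include hκ in
/-- ★★ Module form: **`ofPS (map κ (toPS (c • m))) = (map κ c) • ofPS (map κ (toPS m))`**. [cite: deShalit1987, Ch. I §3.7] -/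
theorem ofPS_map_toPS_smul (c : PowerSeries S) (m : ColemanCoordModule hπ hq ι u hu γ) :
    (TActModule.ofPS _ _ (PowerSeries.map κ (TActModule.toPS (c • m))) : ColemanCoordModule hπ hq ι' u hu γ) =
      PowerSeries.map κ c • TActModule.ofPS _ _ (PowerSeries.map κ (TActModule.toPS m)) := by
  rw [TActModule.toPS_smul, map_tAct hπ hq ι ι' κ hκ u hu γ, TActModule.smul_ofPS]

include hκ in
/-- ★ **`map κ (σ_v m) = σ_v (map κ m)`** (module form). [cite: deShalit1987, Ch. I §3.4 Lemma (ii), §3.7] -/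
theorem ofPS_map_toPS_unitTwistₗ (v : 𝒪[F]ˣ) (m : ColemanCoordModule hπ hq ι u hu γ) :
    (TActModule.ofPS _ _ (PowerSeries.map κ (TActModule.toPS (unitTwistₗ hπ hq ι u hu γ v m))) : ColemanCoordModule hπ hq ι' u hu γ) =
      unitTwistₗ hπ hq ι' u hu γ v (TActModule.ofPS _ _ (PowerSeries.map κ (TActModule.toPS m))) := by
  apply TActModule.toPS_injective
  rw [TActModule.toPS_ofPS, toPS_unitTwistₗ, toPS_unitTwistₗ, TActModule.toPS_ofPS, map_add, map_twistLinearBase hπ hq ι ι' κ hκ]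

omit [IsAdicComplete (Ideal.span {ι (LTCoeff.of F π)}) S] [IsAdicComplete (Ideal.span {ι' (LTCoeff.of F π)}) S'] in
/-- `map κ` of `1 ∈ M` is `1`. [cite: deShalit1987, Ch. I §3.7] -/
theorem ofPS_map_toPS_one :
    (TActModule.ofPS _ _ (PowerSeries.map κ (TActModule.toPS (TActModule.ofPS (twistLinearBase hπ hq ι u γ)
        (twistLinearBase_mem_adicFiltGen_succ hπ hq ι u hu γ) 1))) : ColemanCoordModule hπ hq ι' u hu γ) = TActModule.ofPS _ _ 1 := by
  rw [TActModule.toPS_ofPS, map_one]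

/-! ### §2. `φ_ε` and the twist scalars under base change -/

variable (hreg : ∀ x : S, ι (LTCoeff.of F π) * x = 0 → x = 0) (hreg' : ∀ x : S', ι' (LTCoeff.of F π) * x = 0 → x = 0)
  (w : 𝒪[F]ˣ) (hγ : (γ : 𝒪[F]) = 1 + π ^ 2 * w) (ε : PowerSeries S)

include hκ in
/-- ★★ **The `Λ[Δ]`-coordinates commute with base change**: if `m = a • 1 + c • σ_{−1}(1)` then `map κ m = (map κ a) • 1 + (map κ c) • σ_{−1}(1)`,
so `repr (map κ m) = map κ ∘ repr m`. [cite: deShalit1987, Ch. I §3.1, §3.7, §3.8 (17)] -/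
theorem repr_coordBasisDelta_map (m : ColemanCoordModule hπ hq ι u hu γ) (j : Fin 2) :
    (coordBasisDelta hπ hq ι' u hu γ hreg' w hγ).repr
        (TActModule.ofPS _ _ (PowerSeries.map κ (TActModule.toPS m)) : ColemanCoordModule hπ hq ι' u hu γ) j =
      PowerSeries.map κ ((coordBasisDelta hπ hq ι u hu γ hreg w hγ).repr m j) := by
  set a := (coordBasisDelta hπ hq ι u hu γ hreg w hγ).repr m 0 with ha
  set c := (coordBasisDelta hπ hq ι u hu γ hreg w hγ).repr m 1 with hc
  have hm : m = a • TActModule.ofPS _ _ 1 + c • unitTwistₗ hπ hq ι u hu γ (-1) (TActModule.ofPS _ _ 1) :=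
    eq_repr_zero_smul_one_add_repr_one_smul hπ hq ι u hu γ hreg w hγ m
  have hm' : (TActModule.ofPS _ _ (PowerSeries.map κ (TActModule.toPS m)) : ColemanCoordModule hπ hq ι' u hu γ) =
      PowerSeries.map κ a • coordBasisDelta hπ hq ι' u hu γ hreg' w hγ 0 + PowerSeries.map κ c • coordBasisDelta hπ hq ι' u hu γ hreg' w hγ 1 := by
    rw [coordBasisDelta_zero, coordBasisDelta_one]
    conv_lhs => rw [hm]
    rw [map_add (TActModule.toPS (D := twistLinearBase hπ hq ι u γ)), map_add, map_add (TActModule.ofPS (twistLinearBase hπ hq ι' u γ) _),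
      ofPS_map_toPS_smul hπ hq ι ι' κ hκ u hu γ, ofPS_map_toPS_smul hπ hq ι ι' κ hκ u hu γ, ofPS_map_toPS_unitTwistₗ hπ hq ι ι' κ hκ u hu γ,
      ofPS_map_toPS_one hπ hq ι ι' κ u hu γ]
  rw [hm', map_add, map_smul, map_smul, Module.Basis.repr_self, Module.Basis.repr_self]
  fin_cases j
  · simp [ha]
  · simp [hc]

include hκ in
/-- ★★★ **`φ_ε` COMMUTES WITH BASE CHANGE: `φ_{map κ ε}(map κ m) = map κ (φ_ε m)`** — every specialisation of the coefficients (e.g. `X ↦ 0`,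
`X ↦ ζ − 1` of the unramified variable) carries the two-variable `ε`-projection to the one-level one. [cite: deShalit1987, Ch. I §3.7, §3.8 (17); Ch. III §1.8] -/
theorem colemanDeltaCoinvFun_map (m : ColemanCoordModule hπ hq ι u hu γ) :
    colemanDeltaCoinvFun hπ hq ι' u hu γ hreg' w hγ (PowerSeries.map κ ε)
        (TActModule.ofPS _ _ (PowerSeries.map κ (TActModule.toPS m)) : ColemanCoordModule hπ hq ι' u hu γ) =
      PowerSeries.map κ (colemanDeltaCoinvFun hπ hq ι u hu γ hreg w hγ ε m) := by
  rw [deltaCoinvFun_apply, deltaCoinvFun_apply, repr_coordBasisDelta_map hπ hq ι ι' κ hκ u hu γ hreg hreg' w hγ,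
    repr_coordBasisDelta_map hπ hq ι ι' κ hκ u hu γ hreg hreg' w hγ, map_add, map_mul]

include hκ in
/-- ★★ **The twist scalars are base-change invariant: `t_v^{S', map κ ε} = map κ (t_v^{S, ε})`** (`t_v = φ_ε(σ_v 1)`).  In particular the
two-variable scalars over `𝒪_F⟦X⟧` are the constants `map C` of the scalars over `𝒪_F`. [cite: deShalit1987, Ch. I §3.1, §3.7, §3.8 (17)] -/
theorem colemanDeltaCoinvFun_unitTwistₗ_one_map (v : 𝒪[F]ˣ) :
    colemanDeltaCoinvFun hπ hq ι' u hu γ hreg' w hγ (PowerSeries.map κ ε) (unitTwistₗ hπ hq ι' u hu γ v (TActModule.ofPS _ _ 1)) =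
      PowerSeries.map κ (colemanDeltaCoinvFun hπ hq ι u hu γ hreg w hγ ε (unitTwistₗ hπ hq ι u hu γ v (TActModule.ofPS _ _ 1))) := by
  rw [← colemanDeltaCoinvFun_map hπ hq ι ι' κ hκ u hu γ hreg hreg' w hγ ε, ofPS_map_toPS_unitTwistₗ hπ hq ι ι' κ hκ u hu γ,
    ofPS_map_toPS_one hπ hq ι ι' κ u hu γ]

end CoordBaseChangeTwo

end Literature.NumberTheory.GaloisRepresentations
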